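import Summits.ValiantsHypothesis.ValiantsHypothesis.Theorems.KPlusLogSqLawTropicalBMasterLawComplete

/-!
# Route `KPlusLogSqLaw`, crux `TropicalB` (stmt-ValiantsHypothesis-19771) — CONVERSE OF THE MASTER LAW, part 2b:
# the SIGNED realisability criterion — signs separate from valuations

HONEST FRAMING.  Helper file (seat val-sym-trop-p1 g26, cell `pub-symmetroid`, 2026-08-29; `--supports stmt-ValiantsHypothesis-19771
--as helper`) toward the registered stubs `stub_tropThin` / `stub_tropFat` of `Cruxes/TropicalB/Lines/birth.lean` (crux
`Summit.ValiantsHypothesis.ValiantsHypothesis.Theses.KPlusLogSqLaw.TropicalB`, route `KPlusLogSqLaw`).  Structure theorems (exact criteria),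
route-independent imports; nothing here bounds anything: `TropicalB` / both stubs stay OPEN; nothing on `WeakLifting`, the cell's census
values, DoorA26 / DoorA34, `MatrixDescartes` (stmt-ValiantsHypothesis-18050) or VP ≠ VNP.

THE POINT.  The crux and the signed census row `TropRootLawAt m K B` ask for SIGN-ALTERNATING dominant chains.  Part 2
(`…TropicalBMasterLawComplete`) settled the unsigned question: a term sequence is a dominant chain of some design iff it carries no
Farkas certificate, and then it is one on the CANONICAL SUPPORT (the `{0,1}` indicator of its own incidences).  Signs ride on top
INDEPENDENTLY: dominance only sees the zero set of the pattern `ε` (`isDominant_mul_signs`), so a sign pattern can be multiplied into the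
canonical support without touching dominance (`termSign_mul_signs`).  Hence

* `exists_signedDesign_iff` — **SIGNED REALISABILITY CRITERION**: `p 0, …, p n` is a sign-alternating dominant chain of SOME design
  `(d, v, ε)`, `|ε| ≤ 1`, at some integer slopes `θ 0 < ⋯ < θ n` ⟺ (no certificate) ∧ (some `±1`-valued table `s` on the cells makes the
  formal signs `termSign s (p k)` alternate).  The second conjunct is a linear system over 𝔽₂ in the cell signs (the parity of
  `sign σ_k · sign σ_{k+1}` against the symmetric difference of the incidence sets) — valuation-free and slope-free like the first.
* `tropRootLawAt_iff_signedCertificateFree` — the SIGNED row: `TropRootLawAt m K B` ⟺ every term sequence of format `(m, K)` that admits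
  an alternating `±1` sign table and no certificate has `n ≤ B` (exact, no factor two; compare `tropRowD_iff_certificateFree` and the
  unsigned/signed bridge `tropRowD_of_tropRootLawAt` of …TropicalBSignsFree).
The crux form `TropicalB ⟺ …` (which must import the route file) is in `…TropicalBMasterLawCruxForm`.
[folklore: LP duality; sign bookkeeping; packaging this cell]
-/

set_option linter.dupNamespace false
set_option autoImplicit false

namespace Summit.ValiantsHypothesis.ValiantsHypothesis.Theorems.KPlusLogSqLaw.MasterLaw

open Summit.ValiantsHypothesis.ValiantsHypothesis.Theorems.MatrixDescartes.Negative
open Summit.ValiantsHypothesis.ValiantsHypothesis.Theorems.KPlusLogSqLaw.ConvexPosition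
open Summit.ValiantsHypothesis.ValiantsHypothesis.Theorems.LacunarySymmetroidMatrixDescartes.TropicalCensus (slope TropRootLawAt)
open scoped BigOperators
open Finset

variable {m K : ℕ}

/-! ## 1. Signs ride on top of the presence pattern -/

/-- multiplying a presence pattern `ε₀` by a sign table `s` multiplies the formal sign of every term by the product of `ε₀` over its
incidences. [folklore] -/
theorem termSign_mul_signs (ε₀ s : Fin m → Fin m → Fin K → ℤ) (q : Equiv.Perm (Fin m) × (Fin m → Fin K)) :
    termSign (fun a b l => ε₀ a b l * s a b l) q = termSign s q * ∏ b, ε₀ (q.1 b) b (q.2 b) := by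
  unfold termSign
  rw [Finset.prod_mul_distrib]
  ring

/-- dominance only sees the ZERO SET of the pattern: two patterns with the same present terms have the same dominant terms. [folklore] -/
theorem isDominant_of_termSign_ne_zero_iff (d : Fin K → ℕ) (v ε ε' : Fin m → Fin m → Fin K → ℤ)
    (h : ∀ q : Equiv.Perm (Fin m) × (Fin m → Fin K), termSign ε q ≠ 0 ↔ termSign ε' q ≠ 0) (θ : ℤ)
    (t : Equiv.Perm (Fin m) × (Fin m → Fin K)) (ht : IsDominant d v ε θ t) : IsDominant d v ε' θ t :=
  ⟨(h t).mp ht.1, fun q hq hq' => ht.2 q hq ((h q).mpr hq')⟩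

/-! ## 2. The signed criterion -/

/-- **SIGNED REALISABILITY CRITERION (kernel iff).**  For any exponents `d` and terms `p 0, …, p n` of format `(m, K)`: there is a design
`(d, v, ε)` with `|ε| ≤ 1` and integer slopes `θ 0 < ⋯ < θ n` such that every `p k` is the unique optimum at `θ k` AND consecutive formal
signs alternate (`termSign ε (p k) · termSign ε (p (k+1)) < 0`) IF AND ONLY IF (i) the sequence carries no Farkas certificate (as in
`exists_design_iff_no_certificate`) and (ii) some `±1`-valued table `s` on the cells makes `termSign s (p k)` alternate.  Signs and
valuations are independent: (ii) is a parity condition on the chain alone. [this cell] -/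
theorem exists_signedDesign_iff (d : Fin K → ℕ) (n : ℕ) (p : ℕ → Equiv.Perm (Fin m) × (Fin m → Fin K)) :
    (∃ (v ε : Fin m → Fin m → Fin K → ℤ) (θ : ℕ → ℤ), (∀ i j l, (ε i j l).natAbs ≤ 1) ∧
      (∀ k < n, θ k < θ (k + 1)) ∧ (∀ k ≤ n, IsDominant d v ε (θ k) (p k)) ∧
      ∀ k < n, termSign ε (p k) * termSign ε (p (k + 1)) < 0) ↔
    ((∀ lam : ℕ → (Equiv.Perm (Fin m) × (Fin m → Fin K)) → ℚ, (∀ k q, 0 ≤ lam k q) →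
      (∀ k q, lam k q ≠ 0 → k ≤ n ∧ q ≠ p k ∧ ∀ b, ∃ k' ≤ n, (p k').1 b = q.1 b ∧ (p k').2 b = q.2 b) →
      (∀ F : Fin m × Fin m × Fin K → ℤ, ∑ k ∈ range (n + 1), ∑ q, lam k q * ((ev F (p k) : ℚ) - (ev F q : ℚ)) = 0) →
      (∀ k < n, 0 ≤ ∑ k' ∈ range (k + 1), ∑ q, lam k' q * ((slope d (p k') : ℚ) - (slope d q : ℚ))) →
      ∀ k q, lam k q = 0) ∧
    ∃ s : Fin m → Fin m → Fin K → ℤ, (∀ a b l, s a b l = 1 ∨ s a b l = -1) ∧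
      ∀ k < n, termSign s (p k) * termSign s (p (k + 1)) < 0) := by
  classical
  constructor
  · rintro ⟨v, ε, θ, hε, hθ, hdom, halt⟩
    refine ⟨fun lam hlam hsupp hbal hpre => no_certificate_of_design d n p v ε θ hθ hdom lam hlam hsupp hbal hpre, ?_⟩
    -- the sign table read off `ε` on the chain's incidences
    refine ⟨fun a b l => if ε a b l = -1 then -1 else 1, fun a b l => by dsimp only; split_ifs <;> simp, fun k hk => ?_⟩
    -- on chain incidences `ε = ±1`, so the formal signs agree
    have hagree : ∀ k ≤ n, termSign (fun a b l => if ε a b l = -1 then (-1 : ℤ) else 1) (p k) = termSign ε (p k) := by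
      intro k hk
      have hpres := (hdom k hk).1
      unfold termSign at hpres ⊢
      congr 1
      refine Finset.prod_congr rfl fun b _ => ?_
      have hne : ε ((p k).1 b) b ((p k).2 b) ≠ 0 :=
        (Finset.prod_ne_zero_iff.mp (right_ne_zero_of_mul hpres)) b (Finset.mem_univ b)
      have hle := hε ((p k).1 b) b ((p k).2 b)
      have : ε ((p k).1 b) b ((p k).2 b) = 1 ∨ ε ((p k).1 b) b ((p k).2 b) = -1 := by
        rcases Int.natAbs_eq (ε ((p k).1 b) b ((p k).2 b)) with h | h <;> omega
      show (if ε ((p k).1 b) b ((p k).2 b) = -1 then (-1 : ℤ) else 1) = ε ((p k).1 b) b ((p k).2 b)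
      rcases this with h | h
      · rw [if_neg (by rw [h]; decide), h]
      · rw [if_pos h, h]
    rw [hagree k (by omega), hagree (k + 1) (by omega)]
    exact halt k hk
  · rintro ⟨hfree, s, hs, halt⟩
    obtain ⟨v, θ, hθ, hdom⟩ := exists_design_of_no_certificate d n p hfree
    -- multiply the sign table into the canonical support
    let ε₀ : Fin m → Fin m → Fin K → ℤ := fun a b l => if ∃ k' ≤ n, (p k').1 b = a ∧ (p k').2 b = l then 1 else 0
    let ε : Fin m → Fin m → Fin K → ℤ := fun a b l => ε₀ a b l * s a b l
    have hs0 : ∀ a b l, s a b l ≠ 0 := by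
      intro a b l; rcases hs a b l with h | h <;> simp [h]
    have hsT : ∀ q : Equiv.Perm (Fin m) × (Fin m → Fin K), termSign s q ≠ 0 := by
      intro q
      unfold termSign
      exact mul_ne_zero (Units.ne_zero _) (Finset.prod_ne_zero_iff.mpr fun b _ => hs0 _ _ _)
    have hzero : ∀ q : Equiv.Perm (Fin m) × (Fin m → Fin K), termSign ε₀ q ≠ 0 ↔ termSign ε q ≠ 0 := by
      intro q
      have h1 : termSign ε q = termSign s q * ∏ b, ε₀ (q.1 b) b (q.2 b) := termSign_mul_signs ε₀ s q
      have h0 : termSign ε₀ q = (Equiv.Perm.sign q.1 : ℤ) * ∏ b, ε₀ (q.1 b) b (q.2 b) := rfl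
      rw [h1, h0]
      simp only [ne_eq, mul_eq_zero, Units.ne_zero, false_or, hsT q]
    have hchain : ∀ k ≤ n, termSign ε (p k) = termSign s (p k) := by
      intro k hk
      rw [show termSign ε (p k) = termSign s (p k) * ∏ b, ε₀ ((p k).1 b) b ((p k).2 b) from termSign_mul_signs ε₀ s (p k)]
      rw [Finset.prod_eq_one, mul_one]
      intro b _
      simp only [ε₀]
      rw [if_pos ⟨k, hk, rfl, rfl⟩]
    refine ⟨v, ε, θ, fun a b l => ?_, hθ, fun k hk => ?_, fun k hk => ?_⟩
    · simp only [ε, ε₀]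
      rcases hs a b l with h | h <;> · rw [h]; split_ifs <;> simp
    · exact isDominant_of_termSign_ne_zero_iff d v ε₀ ε hzero (θ k) (p k) (hdom k hk)
    · rw [hchain k (by omega), hchain (k + 1) (by omega)]
      exact halt k hk

/-! ## 3. The signed census row without valuations or slopes -/

/-- **The SIGNED tropical row as a statement about term sequences.**  `TropRootLawAt m K B` ⟺ every sequence `p 0, …, p n` of terms
of format `(m, K)` that admits an alternating `±1` sign table and carries no certificate (for some exponents `d`) has `n ≤ B`.
Exact (no factor two). [this cell] -/
theorem tropRootLawAt_iff_signedCertificateFree (m K B : ℕ) :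
    TropRootLawAt m K B ↔ ∀ (d : Fin K → ℕ) (n : ℕ) (p : ℕ → Equiv.Perm (Fin m) × (Fin m → Fin K)),
      (∃ s : Fin m → Fin m → Fin K → ℤ, (∀ a b l, s a b l = 1 ∨ s a b l = -1) ∧
        ∀ k < n, termSign s (p k) * termSign s (p (k + 1)) < 0) →
      (∀ lam : ℕ → (Equiv.Perm (Fin m) × (Fin m → Fin K)) → ℚ, (∀ k q, 0 ≤ lam k q) →
        (∀ k q, lam k q ≠ 0 → k ≤ n ∧ q ≠ p k ∧ ∀ b, ∃ k' ≤ n, (p k').1 b = q.1 b ∧ (p k').2 b = q.2 b) →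
        (∀ F : Fin m × Fin m × Fin K → ℤ, ∑ k ∈ range (n + 1), ∑ q, lam k q * ((ev F (p k) : ℚ) - (ev F q : ℚ)) = 0) →
        (∀ k < n, 0 ≤ ∑ k' ∈ range (k + 1), ∑ q, lam k' q * ((slope d (p k') : ℚ) - (slope d q : ℚ))) →
        ∀ k q, lam k q = 0) →
      n ≤ B := by
  constructor
  · intro hT d n p hsign hfree
    obtain ⟨v, ε, θ, hε, hθ, hdom, halt⟩ := (exists_signedDesign_iff d n p).mpr ⟨hfree, hsign⟩
    refine hT d v ε n (fun k => θ k) (fun k => p k) hε ?_ (fun k => hdom k (Nat.lt_succ_iff.mp k.isLt)) ?_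
    · rw [Fin.strictMono_iff_lt_succ]
      intro k
      simpa using hθ k k.isLt
    · intro k
      simpa using halt k k.isLt
  · intro H d v ε n θ p hε hθ hdom halt
    let pN : ℕ → Equiv.Perm (Fin m) × (Fin m → Fin K) := fun k => if h : k < n + 1 then p ⟨k, h⟩ else p 0
    let θN : ℕ → ℤ := fun k => if h : k < n + 1 then θ ⟨k, h⟩ else 0
    have hpN : ∀ k (hk : k < n + 1), pN k = p ⟨k, hk⟩ := fun k hk => by simp only [pN, dif_pos hk]
    have hθN : ∀ k (hk : k < n + 1), θN k = θ ⟨k, hk⟩ := fun k hk => by simp only [θN, dif_pos hk]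
    have hθN' : ∀ k < n, θN k < θN (k + 1) := by
      intro k hk
      rw [hθN k (by omega), hθN (k + 1) (by omega)]
      exact hθ (show (⟨k, by omega⟩ : Fin (n + 1)) < ⟨k + 1, by omega⟩ from Fin.mk_lt_mk.mpr (Nat.lt_succ_self k))
    have hdomN : ∀ k ≤ n, IsDominant d v ε (θN k) (pN k) := by
      intro k hk
      rw [hpN k (by omega), hθN k (by omega)]
      exact hdom _
    have haltN : ∀ k < n, termSign ε (pN k) * termSign ε (pN (k + 1)) < 0 := by
      intro k hk
      rw [hpN k (by omega), hpN (k + 1) (by omega)]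
      exact halt ⟨k, hk⟩
    obtain ⟨hfree, hsign⟩ := (exists_signedDesign_iff d n pN).mp ⟨v, ε, θN, hε, hθN', hdomN, haltN⟩
    exact H d n pN hsign hfree

end Summit.ValiantsHypothesis.ValiantsHypothesis.Theorems.KPlusLogSqLaw.MasterLaw
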